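import Mathlib
import Literature.Geometry.Symplectic.SteinBall
import Summits.SmoothPoincare4.SmoothPoincare4.Theorems.HyperbolicEnd.Negative.DiscLineTest

/-!
# `HyperbolicEnd` (stmt-SmoothPoincare4-7825), line `Sketch`, negative side — growth along `J₀`-complex lines of `ℝ⁴`

Helper for the negative side of the line `Sketch` (`Theorems/HyperbolicEnd/Negative/`, native
frozen-`J` refutation on `ℝ⁴ = ℂ²` with `J = J₀ = stdComplexStructure`); statement registered on
the crux item (stub helper_frozen_lineGrowthE4).  This is the `ℝ⁴ / J₀` version of
`helper_lineGrowth` (`LineGrowth.lean`, same folder), with the complex line `w ↦ x₀ + w v` of `ℂ`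
replaced by the `J₀`-complex line `w ↦ x₀ + (re w) v + (im w) J₀ v` of `ℝ⁴`.

**The bound.** Let `F'` be a density on `ℝ⁴`, positive definite over the ball `‖x‖ < R`, and
certified there with constant `c' > 0`: along every smooth `J₀`-holomorphic curve
`g : U → {‖x‖ < R}` (`Dg (iζ) = J₀ Dg (ζ)`) the function `λ(w) = F'(g w)(∂ₓ g w)` is `C²` on `U`
with `2c'λ³ ≤ λΔλ - |∇λ|²`.  Then for `‖x₀‖ < R` and `v ≠ 0`,
`F'(x₀, v) ≤ 16‖v‖² / (c'(R - ‖x₀‖)²)`.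

*Proof.* With `ρ = (R - ‖x₀‖)/‖v‖` the `J₀`-complex line `g(w) = x₀ + (re w) v + (im w) J₀ v`
is smooth (affine) with differential `L ζ = (re ζ) v + (im ζ) J₀ v`, so `∂ₓ g = L 1 = v` and
`L (iζ) = -(im ζ) v + (re ζ) J₀ v = J₀ (L ζ)` (`J₀² = -1`); since `v ⊥ J₀ v` and `‖J₀ v‖ = ‖v‖`,
`‖g(w) - x₀‖ = ‖w‖ ‖v‖`, so `g` maps the disc `‖w‖ < ρ` into `‖x‖ < R`.  Hence
`λ(w) = F'(g w)(v)` is `C²`, positive, and satisfies the curvature inequality on `‖w‖ < ρ`.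
With `ρ' = ρ/2`, the continuous function `Q = λ · (ρ'² - ‖w‖²)²` attains its maximum on the
closed disc `‖w‖ ≤ ρ'` at an interior point `w*` (`Q(0) > 0 = Q|∂`), and the disc line test
(`helper_discLineTest` of the sibling `DiscLineTest.lean`) gives `c' Q(w*) ≤ 4ρ'²`; hence
`c' λ(0) ρ'⁴ = c' Q(0) ≤ 4ρ'²`, i.e. `F'(x₀, v) = λ(0) ≤ 4/(c'ρ'²) = 16‖v‖²/(c'(R - ‖x₀‖)²)`.
-/

noncomputable section

-- the prescribed namespace `Summit.<P>.<Sub>.…` duplicates `SmoothPoincare4` (P = Sub)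
set_option linter.dupNamespace false

open scoped ContDiff Topology Real
open Laplacian Set Filter Metric Complex
open Literature.Geometry.Symplectic

namespace Summit.SmoothPoincare4.SmoothPoincare4.Theorems.HyperbolicEnd.Negative

/-! ### The `J₀`-complex line `w ↦ x₀ + (re w) v + (im w) J₀ v` -/

/-- `J₀` is an isometry of `ℝ⁴`: `‖J₀ v‖ = ‖v‖`. -/
private theorem norm_stdComplexStructure_eq (v : EuclideanSpace ℝ (Fin 4)) :
    ‖stdComplexStructure v‖ = ‖v‖ := by
  have h : ‖stdComplexStructure v‖ ^ 2 = ‖v‖ ^ 2 := by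
    rw [← real_inner_self_eq_norm_sq, ← real_inner_self_eq_norm_sq,
      inner_stdComplexStructure_stdComplexStructure]
  exact (sq_eq_sq₀ (norm_nonneg _) (norm_nonneg _)).1 h

/-- `‖a v + b J₀ v‖² = (a² + b²) ‖v‖²`, since `v ⊥ J₀ v` and `‖J₀ v‖ = ‖v‖`. -/
private theorem norm_sq_smul_add_smul_stdComplexStructure (v : EuclideanSpace ℝ (Fin 4))
    (a b : ℝ) : ‖a • v + b • stdComplexStructure v‖ ^ 2 = (a ^ 2 + b ^ 2) * ‖v‖ ^ 2 := by
  rw [norm_add_sq_real, real_inner_smul_left, real_inner_smul_right,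
    inner_stdComplexStructure_self, norm_smul, norm_smul, norm_stdComplexStructure_eq,
    Real.norm_eq_abs, Real.norm_eq_abs, mul_pow, mul_pow, sq_abs, sq_abs]
  ring

/-- Along the `J₀`-complex line in direction `v`: `‖(re w) v + (im w) J₀ v‖ = ‖w‖ ‖v‖`. -/
private theorem norm_reSmul_add_imSmul_stdComplexStructure (v : EuclideanSpace ℝ (Fin 4))
    (w : ℂ) : ‖w.re • v + w.im • stdComplexStructure v‖ = ‖w‖ * ‖v‖ := by
  have h : ‖w.re • v + w.im • stdComplexStructure v‖ ^ 2 = (‖w‖ * ‖v‖) ^ 2 := by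
    rw [norm_sq_smul_add_smul_stdComplexStructure, mul_pow, Complex.sq_norm,
      Complex.normSq_apply]
    ring
  exact (sq_eq_sq₀ (norm_nonneg _) (by positivity)).1 h

/-! ### The helper -/

/-- helper (frozen, T6): Schwarz-lemma growth bound along `J₀`-complex lines of `ℝ⁴`.  If the
density `F'` is positive definite over the ball `‖x‖ < R` of `ℝ⁴` and certified there with
constant `c' > 0` (along every smooth `J₀`-holomorphic curve `g` into the ball,
`λ = F'(g)(∂ₓg)` is `C²` with `2c'λ³ ≤ λΔλ - |∇λ|²`), then
`F'(x₀, v) ≤ 16‖v‖²/(c'(R - ‖x₀‖)²)` for `‖x₀‖ < R`, `v ≠ 0`. -/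
theorem helper_frozen_lineGrowthE4 :
    ∀ (F' : EuclideanSpace ℝ (Fin 4) → EuclideanSpace ℝ (Fin 4) → ℝ) (c' R : ℝ)
      (x₀ v : EuclideanSpace ℝ (Fin 4)), 0 < c' → ‖x₀‖ < R → v ≠ 0 →
    (∀ x ∈ Metric.ball (0 : EuclideanSpace ℝ (Fin 4)) R, ∀ u : EuclideanSpace ℝ (Fin 4),
      0 ≤ F' x u ∧ (F' x u = 0 → u = 0)) →
    (∀ (U : Set ℂ) (g : ℂ → EuclideanSpace ℝ (Fin 4)), IsOpen U → ContDiffOn ℝ ∞ g U →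
      (∀ z ∈ U, ∀ ζ : ℂ, fderiv ℝ g z (Complex.I * ζ) =
        Literature.Geometry.Symplectic.stdComplexStructure (fderiv ℝ g z ζ)) →
      (∀ z ∈ U, g z ∈ Metric.ball (0 : EuclideanSpace ℝ (Fin 4)) R) →
      ContDiffOn ℝ 2 (fun w => F' (g w) (fderiv ℝ g w 1)) U ∧
        ∀ z ∈ U, 2 * c' * (F' (g z) (fderiv ℝ g z 1)) ^ 3 ≤
          F' (g z) (fderiv ℝ g z 1) * (Δ (fun w => F' (g w) (fderiv ℝ g w 1))) z -
            ((fderiv ℝ (fun w => F' (g w) (fderiv ℝ g w 1)) z 1) ^ 2 +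
              (fderiv ℝ (fun w => F' (g w) (fderiv ℝ g w 1)) z Complex.I) ^ 2)) →
    F' x₀ v ≤ 16 * ‖v‖ ^ 2 / (c' * (R - ‖x₀‖) ^ 2) := by
  intro F' c' R x₀ v hc hx₀ hv hposdef hcert
  -- basic quantities: `ρ = (R - ‖x₀‖)/‖v‖ > 0`
  have hnv : 0 < ‖v‖ := norm_pos_iff.2 hv
  have hd : 0 < R - ‖x₀‖ := sub_pos.2 hx₀
  set ρ : ℝ := (R - ‖x₀‖) / ‖v‖ with hρdef
  have hρ : 0 < ρ := div_pos hd hnv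
  have hρmul : ρ * ‖v‖ = R - ‖x₀‖ := by
    rw [hρdef]
    exact div_mul_cancel₀ _ hnv.ne'
  -- the differential `L ζ = (re ζ) v + (im ζ) J₀ v` of the `J₀`-complex line
  obtain ⟨L, hL⟩ : ∃ L : ℂ →L[ℝ] EuclideanSpace ℝ (Fin 4),
      ∀ ζ : ℂ, L ζ = ζ.re • v + ζ.im • stdComplexStructure v :=
    ⟨Complex.reCLM.smulRight v + Complex.imCLM.smulRight (stdComplexStructure v),
      fun ζ => by simp⟩
  -- the `J₀`-complex line `g(w) = x₀ + (re w) v + (im w) J₀ v`: smooth, `J₀`-holomorphic,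
  -- `∂ₓ g = v`, maps `‖w‖ < ρ` into `‖x‖ < R`
  set g : ℂ → EuclideanSpace ℝ (Fin 4) := fun z => x₀ + L z with hgdef
  have hgderiv : ∀ w, HasFDerivAt g L w := fun w => L.hasFDerivAt.const_add x₀
  have hfg : ∀ w, fderiv ℝ g w = L := fun w => (hgderiv w).fderiv
  have hg1 : ∀ w, fderiv ℝ g w 1 = v := fun w => by
    rw [hfg, hL, Complex.one_re, Complex.one_im, one_smul, zero_smul, add_zero]
  have hgU : ∀ z ∈ ball (0 : ℂ) ρ, g z ∈ ball (0 : EuclideanSpace ℝ (Fin 4)) R := by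
    intro z hz
    rw [mem_ball_zero_iff] at hz ⊢
    calc ‖x₀ + L z‖ ≤ ‖x₀‖ + ‖L z‖ := norm_add_le _ _
      _ = ‖x₀‖ + ‖z‖ * ‖v‖ := by rw [hL, norm_reSmul_add_imSmul_stdComplexStructure]
      _ < ‖x₀‖ + ρ * ‖v‖ := by linarith [mul_lt_mul_of_pos_right hz hnv]
      _ = R := by rw [hρmul]; ring
  have hgs : ContDiff ℝ ∞ g := contDiff_const.add L.contDiff
  have hghol : ∀ z ∈ ball (0 : ℂ) ρ, ∀ ζ : ℂ,
      fderiv ℝ g z (Complex.I * ζ) = stdComplexStructure (fderiv ℝ g z ζ) := by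
    intro z _ ζ
    simp only [hfg, hL, Complex.I_mul_re, Complex.I_mul_im, map_add, map_smul,
      stdComplexStructure_sq, smul_neg, neg_smul]
    abel
  obtain ⟨hlamC2, hlamineq⟩ := hcert (ball (0 : ℂ) ρ) g isOpen_ball hgs.contDiffOn hghol hgU
  -- the density along the line
  set lam : ℂ → ℝ := fun w => F' (g w) (fderiv ℝ g w 1) with hlamdef
  have hlam_pos : ∀ z ∈ ball (0 : ℂ) ρ, 0 < lam z := by
    intro z hz
    show 0 < F' (g z) (fderiv ℝ g z 1)
    obtain ⟨h0, h1⟩ := hposdef (g z) (hgU z hz) (fderiv ℝ g z 1)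
    rcases h0.lt_or_eq with h | h
    · exact h
    · exact absurd ((hg1 z).symm.trans (h1 h.symm)) hv
  have hlam0 : lam 0 = F' x₀ v := by
    show F' (g 0) (fderiv ℝ g 0 1) = F' x₀ v
    rw [hg1 0]
    show F' (x₀ + L 0) v = F' x₀ v
    rw [map_zero, add_zero]
  -- the weighted function `Q = λ (ρ'² - ‖w‖²)²` on the closed half disc
  set ρ' : ℝ := ρ / 2 with hρ'def
  have hρ' : 0 < ρ' := by positivity
  have hρ'ρ : ρ' < ρ := by rw [hρ'def]; linarith
  have hsub : closedBall (0 : ℂ) ρ' ⊆ ball (0 : ℂ) ρ := closedBall_subset_ball hρ'ρ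
  set Q : ℂ → ℝ := fun z => lam z * (ρ' ^ 2 - ‖z‖ ^ 2) ^ 2 with hQdef
  have hQcont : ContinuousOn Q (closedBall (0 : ℂ) ρ') := by
    show ContinuousOn (fun z => lam z * (ρ' ^ 2 - ‖z‖ ^ 2) ^ 2) (closedBall (0 : ℂ) ρ')
    exact (hlamC2.continuousOn.mono hsub).mul (by fun_prop)
  obtain ⟨w, hw, hwmax⟩ := (isCompact_closedBall (0 : ℂ) ρ').exists_isMaxOn
    ⟨0, mem_closedBall_self hρ'.le⟩ hQcont
  -- the maximum is positive, hence interior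
  have hQ0 : Q 0 = lam 0 * ρ' ^ 4 := by
    show lam 0 * (ρ' ^ 2 - ‖(0 : ℂ)‖ ^ 2) ^ 2 = lam 0 * ρ' ^ 4
    rw [norm_zero]
    ring
  have hQ0pos : 0 < Q 0 := by
    rw [hQ0]
    exact mul_pos (hlam_pos 0 (mem_ball_self hρ)) (by positivity)
  have hQw : Q 0 ≤ Q w := hwmax (mem_closedBall_self hρ'.le)
  have hw' : ‖w‖ < ρ' := by
    rcases (mem_closedBall_zero_iff.1 hw).lt_or_eq with h | h
    · exact h
    · exfalso
      have hQw0 : Q w = 0 := by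
        show lam w * (ρ' ^ 2 - ‖w‖ ^ 2) ^ 2 = 0
        rw [h]
        ring
      linarith
  have hwU : w ∈ ball (0 : ℂ) ρ := hsub hw
  have hlocmax : IsLocalMax Q w :=
    hwmax.isLocalMax (closedBall_mem_nhds_of_mem (mem_ball_zero_iff.2 hw'))
  have hlamw : ContDiffAt ℝ 2 lam w := hlamC2.contDiffAt (isOpen_ball.mem_nhds hwU)
  -- the disc line test at the maximum: `c' Q(0) ≤ c' Q(w) ≤ 4ρ'²`
  have htest := helper_discLineTest lam w ρ' c' hlamw (hlam_pos w hwU) hw' (hlamineq w hwU) hlocmax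
  have hkey : c' * (lam 0 * ρ' ^ 4) ≤ 4 * ρ' ^ 2 := by
    calc c' * (lam 0 * ρ' ^ 4) = c' * Q 0 := by rw [hQ0]
      _ ≤ c' * Q w := mul_le_mul_of_nonneg_left hQw hc.le
      _ ≤ 4 * ρ' ^ 2 := htest
  have hkey' : c' * lam 0 * ρ' ^ 2 ≤ 4 := by
    have h1 : ρ' ^ 2 * (c' * lam 0 * ρ' ^ 2) ≤ ρ' ^ 2 * 4 := by
      calc ρ' ^ 2 * (c' * lam 0 * ρ' ^ 2) = c' * (lam 0 * ρ' ^ 4) := by ring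
        _ ≤ 4 * ρ' ^ 2 := hkey
        _ = ρ' ^ 2 * 4 := by ring
    exact le_of_mul_le_mul_left h1 (by positivity)
  -- conclusion: `λ(0) ≤ 4/(c'ρ'²) = 16‖v‖²/(c'(R - ‖x₀‖)²)`
  have hdeq : R - ‖x₀‖ = 2 * ρ' * ‖v‖ := by
    rw [hρ'def, ← hρmul]
    ring
  rw [← hlam0, le_div_iff₀ (mul_pos hc (pow_pos hd 2)), hdeq]
  calc lam 0 * (c' * (2 * ρ' * ‖v‖) ^ 2) = 4 * ‖v‖ ^ 2 * (c' * lam 0 * ρ' ^ 2) := by ring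
    _ ≤ 4 * ‖v‖ ^ 2 * 4 := by gcongr
    _ = 16 * ‖v‖ ^ 2 := by ring

end Summit.SmoothPoincare4.SmoothPoincare4.Theorems.HyperbolicEnd.Negative

end
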